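import Literature.MathematicalPhysics.QuantumFieldTheory.OSPointVectors
import HarnessLib

/-!
# Continuity and norms of the point vectors (OS II, Ch. V.2: "continuity … evident at each step")

Topic `Literature/MathematicalPhysics/QuantumFieldTheory`; sequel of `OSPointVectors`.
Osterwalder–Schrader II (Comm. Math. Phys. 42 (1975)), Ch. V.2, p. 294: *"In the rest of this
chapter the spatial variables will always play the role of parameters … Continuity with respect to
them will be evident at each step"*, and (5.17)/(5.21): `‖Ψₙ(x, ξ)‖² = S_{2n-1}(−ξ̃, 2x, ξ)`. For
the point vectors `Ψ(x)` of `OSPointVectors` (positive-time ordered configurations `x`) this file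
records exactly these two consequences of the pointwise Gram identity `⟪Ψ(x'), Ψ(x)⟫ = S(θx', x)`
and of the continuity of the density `S` of `𝔖_{2m+2}` (Thm. 4.1):

* `norm_pointVector_sq`, `norm_pointVector_le_sqrt` — `‖Ψ(x)‖² = Re S(gramConfig x x) ≤ ‖S(gramConfig x x)‖`;
* `norm_pointVector_sub_sq` — `‖Ψ(x) − Ψ(x')‖²` in terms of four values of `S`;
* `pointVec` — the point vector as a total function of the configuration (zero off the positive-time
  ordered ones), `isOpen_setOf_posOrdered`, and **`continuousOn_pointVec`: `x ↦ Ψ(x)` is norm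
  continuous on the positive-time ordered configurations**.

## References

* K. Osterwalder, R. Schrader, *Axioms for Euclidean Green's functions II*, Comm. Math. Phys.
  42 (1975) 281–305, Ch. V.2 p. 294, (5.17), (5.21). [OsterwalderSchraderCMP1975]
-/

noncomputable section

open Set Filter Metric
open _root_.Topology
open scoped InnerProductSpace SchwartzMap ComplexConjugate

namespace Literature.MathematicalPhysics.QuantumFieldTheory

open Literature.MathematicalPhysics.QuantumLattice (SchwingerFamily)
open Literature.MathematicalPhysics.QuantumLattice.SchwingerFamily

variable {d : ℕ} [NeZero d]

/-! ### Topology of the configurations -/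

section Topology

variable {m m' : ℕ}

/-- **The positive-time ordered configurations form an open set.** [folklore] -/
theorem isOpen_setOf_posOrdered : IsOpen {x : Fin (m + 1) → EuclideanSpace ℝ (Fin d) | PosOrdered x} := by
  have h : {x : Fin (m + 1) → EuclideanSpace ℝ (Fin d) | PosOrdered x} =
      {x | 0 < x 0 0} ∩ ⋂ i : Fin m, {x | x (Fin.castSucc i) 0 < x i.succ 0} := by
    ext x
    simp only [PosOrdered, mem_setOf_eq, mem_inter_iff, mem_iInter, Fin.strictMono_iff_lt_succ]
  rw [h]
  have hc : ∀ j : Fin (m + 1), Continuous fun x : Fin (m + 1) → EuclideanSpace ℝ (Fin d) => x j 0 := fun j =>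
    (PiLp.continuous_apply 2 _ (0 : Fin d)).comp (continuous_apply j)
  exact (isOpen_lt continuous_const (hc 0)).inter
    (isOpen_iInter_of_finite fun i => isOpen_lt (hc _) (hc _))

/-- The configurations with strictly increasing times form an open set. [folklore] -/
theorem isOpen_setOf_strictMono_time {n : ℕ} :
    IsOpen {y : Fin (n + 1) → EuclideanSpace ℝ (Fin d) | StrictMono fun j => y j 0} := by
  have h : {y : Fin (n + 1) → EuclideanSpace ℝ (Fin d) | StrictMono fun j => y j 0} =
      ⋂ i : Fin n, {y | y (Fin.castSucc i) 0 < y i.succ 0} := by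
    ext y
    simp only [mem_setOf_eq, mem_iInter, Fin.strictMono_iff_lt_succ]
  rw [h]
  have hc : ∀ j : Fin (n + 1), Continuous fun y : Fin (n + 1) → EuclideanSpace ℝ (Fin d) => y j 0 := fun j =>
    (PiLp.continuous_apply 2 _ (0 : Fin d)).comp (continuous_apply j)
  exact isOpen_iInter_of_finite fun i => isOpen_lt (hc _) (hc _)

/-- **The Gram configuration depends continuously on the pair of configurations.** [folklore] -/
theorem continuous_gramConfig :
    Continuous fun p : (Fin (m' + 1) → EuclideanSpace ℝ (Fin d)) × (Fin (m + 1) → EuclideanSpace ℝ (Fin d)) =>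
      gramConfig p.1 p.2 := by
  refine continuous_pi fun J => ?_
  induction J using Fin.addCases with
  | left j =>
    simp only [gramConfig, Fin.append_left]
    exact (QuantumLattice.timeReflection d).continuous.comp ((continuous_apply _).comp continuous_fst)
  | right j =>
    simp only [gramConfig, Fin.append_right]
    exact (continuous_apply _).comp continuous_snd

end Topology

/-! ### Norms of point vectors -/

section Norms

variable {𝔖 : SchwingerFamily (EuclideanSpace ℝ (Fin d))} (hE2 : 𝔖.IsOSReflectionPositive) {m : ℕ}
variable (hE1 : 𝔖.IsEuclideanCovariant) (hE0 : 𝔖.HasLinearGrowth)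
include hE1 hE0

/-- **`‖Ψ(x)‖² = Re S(gramConfig x x)`** for any continuous density `S` of `𝔖_{m+1+(m+1)}` on the
configurations with increasing times (OS (5.21) at `N = 0`). [cite: OsterwalderSchraderCMP1975, Ch. V.2 (5.17), (5.21)] -/
theorem norm_pointVector_sq {x : Fin (m + 1) → EuclideanSpace ℝ (Fin d)} (hx : PosOrdered x)
    {S : (Fin (m + 1 + (m + 1)) → EuclideanSpace ℝ (Fin d)) → ℂ} (hS : ContinuousOn S {y | StrictMono fun j => y j 0})
    (hrep : ∀ y : Fin (m + 1 + (m + 1)) → EuclideanSpace ℝ (Fin d), StrictMono (fun j => y j 0) → ∃ ρ : ℝ, 0 < ρ ∧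
      Metric.ball y ρ ⊆ {y | StrictMono fun j => y j 0} ∧
      ∀ F : 𝓢((Fin (m + 1 + (m + 1)) → EuclideanSpace ℝ (Fin d)), ℂ),
        tsupport (F : (Fin (m + 1 + (m + 1)) → EuclideanSpace ℝ (Fin d)) → ℂ) ⊆ Metric.ball y ρ →
          𝔖 (m + 1 + (m + 1)) F = ∫ z, S z * F z) :
    ‖pointVector hE2 x hx‖ ^ 2 = (S (gramConfig x x)).re := by
  rw [← inner_pointVector hE2 hE1 hE0 hx hx hS hrep, inner_self_eq_norm_sq_to_K]
  norm_cast

/-- `‖Ψ(x)‖ ≤ √‖S(gramConfig x x)‖`. [folklore] -/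
theorem norm_pointVector_le_sqrt {x : Fin (m + 1) → EuclideanSpace ℝ (Fin d)} (hx : PosOrdered x)
    {S : (Fin (m + 1 + (m + 1)) → EuclideanSpace ℝ (Fin d)) → ℂ} (hS : ContinuousOn S {y | StrictMono fun j => y j 0})
    (hrep : ∀ y : Fin (m + 1 + (m + 1)) → EuclideanSpace ℝ (Fin d), StrictMono (fun j => y j 0) → ∃ ρ : ℝ, 0 < ρ ∧
      Metric.ball y ρ ⊆ {y | StrictMono fun j => y j 0} ∧
      ∀ F : 𝓢((Fin (m + 1 + (m + 1)) → EuclideanSpace ℝ (Fin d)), ℂ),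
        tsupport (F : (Fin (m + 1 + (m + 1)) → EuclideanSpace ℝ (Fin d)) → ℂ) ⊆ Metric.ball y ρ →
          𝔖 (m + 1 + (m + 1)) F = ∫ z, S z * F z) :
    ‖pointVector hE2 x hx‖ ≤ Real.sqrt ‖S (gramConfig x x)‖ := by
  refine Real.le_sqrt_of_sq_le ?_
  rw [norm_pointVector_sq hE2 hE1 hE0 hx hS hrep]
  exact Complex.re_le_norm _

/-- **`‖Ψ(x) − Ψ(x')‖²` in terms of the density**:
`Re (S(θx,x) − S(θx,x') − S(θx',x) + S(θx',x'))`. [folklore] -/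
theorem norm_pointVector_sub_sq {x x' : Fin (m + 1) → EuclideanSpace ℝ (Fin d)} (hx : PosOrdered x) (hx' : PosOrdered x')
    {S : (Fin (m + 1 + (m + 1)) → EuclideanSpace ℝ (Fin d)) → ℂ} (hS : ContinuousOn S {y | StrictMono fun j => y j 0})
    (hrep : ∀ y : Fin (m + 1 + (m + 1)) → EuclideanSpace ℝ (Fin d), StrictMono (fun j => y j 0) → ∃ ρ : ℝ, 0 < ρ ∧
      Metric.ball y ρ ⊆ {y | StrictMono fun j => y j 0} ∧
      ∀ F : 𝓢((Fin (m + 1 + (m + 1)) → EuclideanSpace ℝ (Fin d)), ℂ),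
        tsupport (F : (Fin (m + 1 + (m + 1)) → EuclideanSpace ℝ (Fin d)) → ℂ) ⊆ Metric.ball y ρ →
          𝔖 (m + 1 + (m + 1)) F = ∫ z, S z * F z) :
    ‖pointVector hE2 x hx - pointVector hE2 x' hx'‖ ^ 2 =
      (S (gramConfig x x) - S (gramConfig x x') - S (gramConfig x' x) + S (gramConfig x' x')).re := by
  set a := pointVector hE2 x hx
  set b := pointVector hE2 x' hx'
  have h : (⟪a - b, a - b⟫_ℂ) = ⟪a, a⟫_ℂ - ⟪a, b⟫_ℂ - ⟪b, a⟫_ℂ + ⟪b, b⟫_ℂ := by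
    rw [inner_sub_left, inner_sub_right, inner_sub_right]; ring
  rw [← inner_self_eq_norm_sq (𝕜 := ℂ), h, inner_pointVector hE2 hE1 hE0 hx hx hS hrep,
    inner_pointVector hE2 hE1 hE0 hx hx' hS hrep, inner_pointVector hE2 hE1 hE0 hx' hx hS hrep,
    inner_pointVector hE2 hE1 hE0 hx' hx' hS hrep]
  rfl

end Norms

/-! ### The point vector as a function of the configuration, and its continuity -/

section Continuity

variable {𝔖 : SchwingerFamily (EuclideanSpace ℝ (Fin d))} (hE2 : 𝔖.IsOSReflectionPositive) {m : ℕ}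

open Classical in
/-- **The point vector as a total function** of the configuration (`0` off the positive-time
ordered configurations). [cite: OsterwalderSchraderCMP1975, Ch. V.2 (5.17)] -/
def pointVec (x : Fin (m + 1) → EuclideanSpace ℝ (Fin d)) : OSHilbert 𝔖 hE2 :=
  if hx : PosOrdered x then pointVector hE2 x hx else 0

/-- On positive-time ordered configurations `pointVec` is the point vector. [folklore] -/
theorem pointVec_eq {x : Fin (m + 1) → EuclideanSpace ℝ (Fin d)} (hx : PosOrdered x) :
    pointVec hE2 x = pointVector hE2 x hx := by
  rw [pointVec, dif_pos hx]

variable (hE1 : 𝔖.IsEuclideanCovariant) (hE0 : 𝔖.HasLinearGrowth)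
include hE1 hE0

/-- **The point vectors depend norm-continuously on the configuration** (on the open set of
positive-time ordered configurations): `‖Ψ(x) − Ψ(x₀)‖² → 0` as `x → x₀` since all four Gram
entries tend to `S(gramConfig x₀ x₀)` by the continuity of the density (Thm. 4.1). [cite: OsterwalderSchraderCMP1975, Ch. V.2 p. 294] -/
theorem continuousOn_pointVec :
    ContinuousOn (pointVec (m := m) hE2) {x : Fin (m + 1) → EuclideanSpace ℝ (Fin d) | PosOrdered x} := by
  obtain ⟨S, hS, hrep⟩ := schwinger_exists_density_add 𝔖 hE1 hE2 hE0 (m' := m) (m := m)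
  intro x₀ hx₀
  have hx₀' : PosOrdered x₀ := hx₀
  -- the three Gram entries as functions of `x`, continuous at `x₀`
  set U : Set (Fin (m + 1 + (m + 1)) → EuclideanSpace ℝ (Fin d)) := {y | StrictMono fun j => y j 0}
  have hU : IsOpen U := isOpen_setOf_strictMono_time
  have hg0 : gramConfig x₀ x₀ ∈ U := strictMono_gramConfig hx₀' hx₀'
  have hSat : ContinuousAt S (gramConfig x₀ x₀) := hS.continuousAt (hU.mem_nhds hg0)
  have hc1 : Tendsto (fun x => S (gramConfig x x)) (𝓝 x₀) (𝓝 (S (gramConfig x₀ x₀))) :=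
    hSat.tendsto.comp ((continuous_gramConfig.comp (continuous_id.prodMk continuous_id)).tendsto x₀)
  have hc2 : Tendsto (fun x => S (gramConfig x x₀)) (𝓝 x₀) (𝓝 (S (gramConfig x₀ x₀))) :=
    hSat.tendsto.comp ((continuous_gramConfig.comp (continuous_id.prodMk continuous_const)).tendsto x₀)
  have hc3 : Tendsto (fun x => S (gramConfig x₀ x)) (𝓝 x₀) (𝓝 (S (gramConfig x₀ x₀))) :=
    hSat.tendsto.comp ((continuous_gramConfig.comp (continuous_const.prodMk continuous_id)).tendsto x₀)
  -- the squared distance tends to zero within the positive-time ordered configurations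
  have hsq : Tendsto (fun x => ‖pointVec hE2 x - pointVec hE2 x₀‖ ^ 2)
      (𝓝[{x | PosOrdered x}] x₀) (𝓝 0) := by
    have hlim : Tendsto (fun x => (S (gramConfig x x) - S (gramConfig x x₀) - S (gramConfig x₀ x) +
        S (gramConfig x₀ x₀)).re) (𝓝 x₀) (𝓝 0) := by
      have h := ((hc1.sub hc2).sub hc3).add_const (S (gramConfig x₀ x₀))
      simp only [sub_self, zero_sub, neg_add_cancel] at h
      have h' := (Complex.continuous_re.tendsto _).comp h
      rw [Complex.zero_re] at h'
      exact h'
    refine (hlim.mono_left nhdsWithin_le_nhds).congr' ?_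
    filter_upwards [self_mem_nhdsWithin] with x hx
    rw [pointVec_eq hE2 hx, pointVec_eq hE2 hx₀', norm_pointVector_sub_sq hE2 hE1 hE0 hx hx₀' hS hrep]
  -- hence the distance tends to zero
  have hd : Tendsto (fun x => ‖pointVec hE2 x - pointVec hE2 x₀‖) (𝓝[{x | PosOrdered x}] x₀) (𝓝 0) := by
    have h := hsq.sqrt
    rw [Real.sqrt_zero] at h
    refine h.congr fun x => ?_
    rw [Real.sqrt_sq (norm_nonneg _)]
  rw [ContinuousWithinAt, tendsto_iff_norm_sub_tendsto_zero]
  exact hd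

/-- Continuity of the point vector along a continuous family of positive-time ordered
configurations. [folklore] -/
theorem continuous_pointVec_comp {X : Type*} [TopologicalSpace X] {c : X → Fin (m + 1) → EuclideanSpace ℝ (Fin d)}
    (hc : Continuous c) (hpos : ∀ s, PosOrdered (c s)) : Continuous fun s => pointVec hE2 (c s) :=
  (continuousOn_pointVec hE2 hE1 hE0).comp_continuous hc hpos

end Continuity

end Literature.MathematicalPhysics.QuantumFieldTheory
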